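import Summits.HubbardSuperconductivity.HubbardSuperconductivity.Theorems.WidthHaldaneCruxDichotomy
import Summits.HubbardSuperconductivity.HubbardSuperconductivity.Theorems.WidthHaldaneColumnCorrelatorBounds

/-!
# Strategist sketch (generation 1) for crux `WidthHaldaneBridge` (stmt-HubbardSuperconductivity-16311)

Planner `planner-cstrat-stmt-HubbardSuperconductivity-16311-0` (crux-strategist, gen 1, 2026-08-17).
NOT a registered line. This file types — over the LANDED tube vocabulary
`Theorems/WidthHaldaneDefs.lean` (`UniformThermo`, `HaldaneLaw`, `tubeColumnPairCorr`, …) — the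
new attempts recorded in `STRATEGY-CENSUS.md` (gen 1) and kernel-checks every composition, so that
each census heading carries a concrete, elaborated object. No `sorry`: conjecture-strength
statements are `def … : Prop`, never asserted.

Contents
* `HaldaneLawLM`, `UniformLROLM` — the crux's conclusion at ONE `(L, M)`, with and without the
  exponent; `haldaneLaw_iff_LM` (binder shuffle, `Iff.rfl`).
* DECOMPOSITION D1 (the `(L, M)`-plane cut at `L = e^M`, lossless):
  `SubExpBridge` (exponent-FREE uniform column-pair LRO `G_ψ(r) ≥ A·L·M²` on every tube with
  `L ≤ e^M`) and `ExpBridge` (the Haldane law on the exponentially elongated tubes `L > e^M`);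
  `subExpBridge_of_widthHaldaneBridge`, `expBridge_of_widthHaldaneBridge` (both are CONSEQUENCES of
  the crux — the power `r̂^{-C/M}` is bounded below by `e^{-C}` as long as `log r̂ ≤ M`),
  `widthHaldaneBridge_of_subExp_of_exp` (and together they give it back). Finding F4 of the census:
  the "width-indexed family of 1D power laws" is, on every tube that is not exponentially longer
  than wide, a family of plain LRO statements; the Luttinger decay budget is exercised only on
  `L > e^M`.
* F1 made actionable (for the TENURE planner; a strategist does not edit `closes`):
  `DiagonalBridge` (`UniformThermo ⇒` uniform column d-wave pair LRO of the SQUARE tori, exponent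
  free), `diagonalBridge_of_widthHaldaneBridge` (a consequence of the crux), the 2D-hypothesis
  variant `SquareBridge` with `diagonalBridge_of_squareBridge`, and the KERNEL-CHECKED re-glue
  `closes_diag : DiagonalBridge → WidthUniformThermodynamics → HubbardSuperconductivity`
  (the parent route's `closes` with its step (1) replaced; steps (2)–(3) verbatim). So the route
  needs from stmt-16311 exactly its diagonal, exponent-free shadow.
* STRENGTHEN / first-lemma candidates (signatures only, with the provability analysis in the
  docstrings): `KineticFloor` (the Scalapino–White–Zhang f-sum inequality "twist stiffness per site
  ≤ long-bond kinetic energy per bond", provable from the landed `re_expect_gauged_tubeH`, M-uniform,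
  and useless for selection), `TowerCeilingOfDiagonalLRO` (Koma–Tasaki: the diagonal LRO already
  forces the compressibility CEILING of `UniformThermo`).
-/

noncomputable section

namespace Summit.HubbardSuperconductivity.HubbardSuperconductivity.Cruxes.WidthHaldaneBridge.StrategistG1

set_option linter.dupNamespace false

open scoped BigOperators Classical Matrix ComplexConjugate
open Matrix Literature.MathematicalPhysics.QuantumLattice
open Summit.HubbardSuperconductivity.HubbardSuperconductivity.Theorems.WidthHaldane
open Summit.HubbardSuperconductivity.HubbardSuperconductivity.Theses.WidthHaldane
  (WidthHaldaneBridge WidthUniformThermodynamics)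

/-! ## The conclusion at one `(L, M)` -/

/-- The Haldane-form law at ONE pair `(L, M)` with constants `(Ξ, A, R)`: the matrix of
`HaldaneLaw` with both sizes fixed. [cite: Haldane1981, eqs. (4)–(7)] -/
def HaldaneLawLM (U δ : ℝ) (L M : ℕ) [NeZero L] [NeZero M] (Ξ A : ℝ) (R : ℕ) : Prop :=
  ∀ (Λ : Type) [LinearOrder Λ] [Fintype Λ] (e : Λ ≃ ZMod L × ZMod M), ∀ ψ : Fock (Orb Λ),
    star ψ ⬝ᵥ ψ = 1 → IsGroundStateInSector (tubeH0 L M Λ e U) (tubeFilling L M δ) 0 ψ →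
      ∀ r : ZMod L, R ≤ r.val → r.val + R ≤ L →
        A * (L : ℝ) * (M : ℝ) ^ 2 * ((min r.val (L - r.val) : ℕ) : ℝ) ^
            (-(Ξ * Real.sqrt (tubePairCompressibility L M Λ e U δ / tubeStiffness L M Λ e U δ) /
              (M : ℝ))) ≤ tubeColumnPairCorr L M Λ e ψ r

/-- EXPONENT-FREE uniform column-pair long-range order at ONE pair `(L, M)`: every normalised sector
ground state of the untwisted tube has `G_ψ(r) ≥ A·L·M²` at every displacement with `R ≤ r̂`
(the kinematic maximum is `32·L·M²`, `Theorems.WidthHaldane.tubeColumnPairCorr_zero_le`).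
[cite: Scalapino1995, §2 eq. (2.4)] -/
def UniformLROLM (U δ : ℝ) (L M : ℕ) [NeZero L] [NeZero M] (A : ℝ) (R : ℕ) : Prop :=
  ∀ (Λ : Type) [LinearOrder Λ] [Fintype Λ] (e : Λ ≃ ZMod L × ZMod M), ∀ ψ : Fock (Orb Λ),
    star ψ ⬝ᵥ ψ = 1 → IsGroundStateInSector (tubeH0 L M Λ e U) (tubeFilling L M δ) 0 ψ →
      ∀ r : ZMod L, R ≤ r.val → r.val + R ≤ L →
        A * (L : ℝ) * (M : ℝ) ^ 2 ≤ tubeColumnPairCorr L M Λ e ψ r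

/-- Binder shuffle: the crux's conclusion is the conjunction of its `(L, M)` slices. [folklore] -/
theorem haldaneLaw_iff_LM (U δ Ξ A : ℝ) (R M₂ L₁ : ℕ) :
    HaldaneLaw U δ Ξ A R M₂ L₁ ↔ ∀ (L M : ℕ) [NeZero L] [NeZero M], Even L → Even M → M₂ ≤ M →
      M ≤ L → L₁ ≤ L → HaldaneLawLM U δ L M Ξ A R :=
  Iff.rfl

/-! ## DECOMPOSITION D1: the `(L, M)`-plane cut at `L = e^M` -/

/-- D1a — SUB-EXPONENTIAL TUBES CARRY PLAIN LRO: under width-uniform thermodynamics, on every even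
tube whose length is at most exponential in its width (`L ≤ e^M`, which includes every square, every
bounded-aspect-ratio and every polynomially elongated tube) EVERY normalised sector ground state has
exponent-free uniform column d-wave pair coherence `G_ψ(r) ≥ A·L·M²` down to `r̂ ≍ L`, with
width-uniform `A, R`. A CONSEQUENCE of the crux (`subExpBridge_of_widthHaldaneBridge`): the factor
`r̂^{-Ξ√(ẽ″/ρ̃)/M} ≥ e^{-Ξ√(k₀/d₀)}` as soon as `log r̂ ≤ M`. Conjecture-strength (its `M = L`
slice is `DiagonalBridge`, 2D d-wave pair LRO at every window point with uniform thermodynamics).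
[cite: Scalapino1995, §2 eq. (2.4)] [cite: Haldane1981, eqs. (4)–(7)] -/
def SubExpBridge : Prop :=
  ∀ U : ℝ, 0 < U → ∀ δ ∈ Set.Ioo (0 : ℝ) (3 / 10), ∀ (d₀ k₀ : ℝ) (M₁ L₀ : ℕ), 0 < d₀ →
    UniformThermo U δ d₀ k₀ M₁ L₀ →
      ∃ A : ℝ, 0 < A ∧ ∃ R M₂ L₁ : ℕ, ∀ (L M : ℕ) [NeZero L] [NeZero M], Even L → Even M →
        M₂ ≤ M → M ≤ L → L₁ ≤ L → (L : ℝ) ≤ Real.exp (M : ℝ) → UniformLROLM U δ L M A R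

/-- D1b — EXPONENTIALLY ELONGATED TUBES CARRY THE LUTTINGER DECAY: under width-uniform
thermodynamics, the Haldane-form law with width-uniform constants on every even tube with
`L > e^M` — the only sub-family on which the crux's power law is not equivalent to plain LRO.
A consequence of the crux by restriction (`expBridge_of_widthHaldaneBridge`); conjecture-strength
(width-uniform multiband Luther–Emery universality; note that even here `r̂ = R` asks transverse
coherence `G ≍ L·M²` of tubes of unbounded width). [cite: Haldane1981, eqs. (4)–(7)]
[cite: BenfattoFalcoMastropietro2010, Theorem p. 3] -/
def ExpBridge : Prop :=
  ∀ U : ℝ, 0 < U → ∀ δ ∈ Set.Ioo (0 : ℝ) (3 / 10), ∀ (d₀ k₀ : ℝ) (M₁ L₀ : ℕ), 0 < d₀ →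
    UniformThermo U δ d₀ k₀ M₁ L₀ →
      ∃ Ξ : ℝ, 0 < Ξ ∧ ∃ A : ℝ, 0 < A ∧ ∃ R M₂ L₁ : ℕ, ∀ (L M : ℕ) [NeZero L] [NeZero M],
        Even L → Even M → M₂ ≤ M → M ≤ L → L₁ ≤ L → Real.exp (M : ℝ) < (L : ℝ) →
          HaldaneLawLM U δ L M Ξ A R

/-- Real-variable core of F4: if `1 ≤ m`, `log m ≤ Mr`, `0 ≤ s` and `Ξ·s ≤ C` with `Ξ ≥ 0`,
`Mr > 0`, then `e^{-C} ≤ m^{-Ξ s / Mr}`. [folklore] -/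
theorem exp_neg_le_rpow {m Mr s Ξ C : ℝ} (hm : 1 ≤ m) (hlog : Real.log m ≤ Mr) (hs : 0 ≤ s)
    (hΞ : 0 ≤ Ξ) (hsC : Ξ * s ≤ C) (hMr : 0 < Mr) :
    Real.exp (-C) ≤ m ^ (-(Ξ * s / Mr)) := by
  have hm0 : 0 < m := one_pos.trans_le hm
  rw [Real.rpow_def_of_pos hm0]
  apply Real.exp_le_exp.2
  have hlog0 : 0 ≤ Real.log m := Real.log_nonneg hm
  have h1 : Real.log m * (Ξ * s / Mr) ≤ Mr * (Ξ * s / Mr) :=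
    mul_le_mul_of_nonneg_right hlog (by positivity)
  have h2 : Mr * (Ξ * s / Mr) = Ξ * s := by field_simp
  rw [h2] at h1
  have h3 : Real.log m * -(Ξ * s / Mr) = -(Real.log m * (Ξ * s / Mr)) := by ring
  rw [h3]
  linarith

/-- **F4 / D1a is a consequence of the crux.** [folklore] -/
theorem subExpBridge_of_widthHaldaneBridge (h : WidthHaldaneBridge) : SubExpBridge := by
  rw [widthHaldaneBridge_iff] at h
  intro U hU δ hδ d₀ k₀ M₁ L₀ hd₀ hth
  obtain ⟨Ξ, hΞ, A, hA, R, M₂, L₁, hlaw⟩ := h U hU δ hδ d₀ k₀ M₁ L₀ hd₀ hth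
  refine ⟨A * Real.exp (-(Ξ * Real.sqrt (k₀ / d₀))), by positivity, max R 1, max M₂ M₁,
    max L₁ L₀, ?_⟩
  intro L M _ _ hLe hMe hM hML hL hexp Λ _ _ e ψ hψ hGS r hr hrL
  obtain ⟨hstiff, hic0, hick⟩ :=
    hth L M hLe hMe (le_of_max_le_right hM) hML (le_of_max_le_right hL) Λ e
  have key := hlaw L M hLe hMe (le_of_max_le_left hM) hML (le_of_max_le_left hL) Λ e ψ hψ hGS r
    ((le_max_left R 1).trans hr) (le_trans (Nat.add_le_add_left (le_max_left R 1) _) hrL)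
  refine le_trans ?_ key
  -- the displacement `m = r̂` satisfies `1 ≤ m ≤ L ≤ e^M`
  have hm1 : (1 : ℝ) ≤ ((min r.val (L - r.val) : ℕ) : ℝ) := by
    have h1 : 1 ≤ r.val := (le_max_right R 1).trans hr
    have h2 : 1 ≤ L - r.val := by
      have := le_trans (Nat.add_le_add_left (le_max_right R 1) _) hrL
      omega
    exact_mod_cast le_min h1 h2
  have hmL : ((min r.val (L - r.val) : ℕ) : ℝ) ≤ (L : ℝ) := by
    have : min r.val (L - r.val) ≤ L := (min_le_right _ _).trans (Nat.sub_le _ _)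
    exact_mod_cast this
  have hMpos : (0 : ℝ) < (M : ℝ) := by exact_mod_cast Nat.pos_of_ne_zero (NeZero.ne M)
  have hlog : Real.log ((min r.val (L - r.val) : ℕ) : ℝ) ≤ (M : ℝ) := by
    have hm0 : (0 : ℝ) < ((min r.val (L - r.val) : ℕ) : ℝ) := one_pos.trans_le hm1
    calc Real.log ((min r.val (L - r.val) : ℕ) : ℝ) ≤ Real.log (Real.exp (M : ℝ)) :=
          Real.log_le_log hm0 (hmL.trans hexp)
      _ = (M : ℝ) := Real.log_exp _
  have hk₀ : 0 < k₀ := hic0.trans_le hick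
  have hs : Real.sqrt (tubePairCompressibility L M Λ e U δ / tubeStiffness L M Λ e U δ) ≤
      Real.sqrt (k₀ / d₀) := by
    apply Real.sqrt_le_sqrt
    rw [div_le_div_iff₀ (hd₀.trans_le hstiff) hd₀]
    calc _ ≤ k₀ * d₀ := mul_le_mul_of_nonneg_right hick hd₀.le
      _ ≤ k₀ * _ := mul_le_mul_of_nonneg_left hstiff hk₀.le
  have hcore := exp_neg_le_rpow hm1 hlog (Real.sqrt_nonneg _) hΞ.le
    (mul_le_mul_of_nonneg_left hs hΞ.le) hMpos
  have hLM : (0 : ℝ) ≤ A * (L : ℝ) * (M : ℝ) ^ 2 := by positivity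
  calc A * Real.exp (-(Ξ * Real.sqrt (k₀ / d₀))) * (L : ℝ) * (M : ℝ) ^ 2
        = A * (L : ℝ) * (M : ℝ) ^ 2 * Real.exp (-(Ξ * Real.sqrt (k₀ / d₀))) := by ring
    _ ≤ A * (L : ℝ) * (M : ℝ) ^ 2 * ((min r.val (L - r.val) : ℕ) : ℝ) ^
          (-(Ξ * Real.sqrt (tubePairCompressibility L M Λ e U δ / tubeStiffness L M Λ e U δ) /
            (M : ℝ))) := mul_le_mul_of_nonneg_left hcore hLM

/-- D1b is a consequence of the crux (restriction). [folklore] -/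
theorem expBridge_of_widthHaldaneBridge (h : WidthHaldaneBridge) : ExpBridge := by
  rw [widthHaldaneBridge_iff] at h
  intro U hU δ hδ d₀ k₀ M₁ L₀ hd₀ hth
  obtain ⟨Ξ, hΞ, A, hA, R, M₂, L₁, hlaw⟩ := h U hU δ hδ d₀ k₀ M₁ L₀ hd₀ hth
  refine ⟨Ξ, hΞ, A, hA, R, M₂, L₁, ?_⟩
  intro L M _ _ hLe hMe hM hML hL _ Λ _ _ e ψ hψ hGS r hr hrL
  exact hlaw L M hLe hMe hM hML hL Λ e ψ hψ hGS r hr hrL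

/-- **The cut is lossless**: D1a ∧ D1b ⇒ the crux (case split on `L ≤ e^M`; on the sub-exponential
side the exponent-free bound dominates the Haldane-form one because `r̂^{-x} ≤ 1` for `r̂ ≥ 1`,
`x ≥ 0`). [folklore] -/
theorem widthHaldaneBridge_of_subExp_of_exp (h1 : SubExpBridge) (h2 : ExpBridge) :
    WidthHaldaneBridge := by
  rw [widthHaldaneBridge_iff]
  intro U hU δ hδ d₀ k₀ M₁ L₀ hd₀ hth
  obtain ⟨A₁, hA₁, R₁, M₂, L₁, hsub⟩ := h1 U hU δ hδ d₀ k₀ M₁ L₀ hd₀ hth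
  obtain ⟨Ξ, hΞ, A₂, hA₂, R₂, M₂', L₁', hexp⟩ := h2 U hU δ hδ d₀ k₀ M₁ L₀ hd₀ hth
  refine ⟨Ξ, hΞ, min A₁ A₂, lt_min hA₁ hA₂, max (max R₁ R₂) 1, max M₂ M₂', max L₁ L₁', ?_⟩
  intro L M _ _ hLe hMe hM hML hL Λ _ _ e ψ hψ hGS r hr hrL
  have hR1 : R₁ ≤ r.val := ((le_max_left R₁ R₂).trans (le_max_left _ 1)).trans hr
  have hR1' : r.val + R₁ ≤ L :=
    le_trans (Nat.add_le_add_left ((le_max_left R₁ R₂).trans (le_max_left _ 1)) _) hrL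
  have hR2 : R₂ ≤ r.val := ((le_max_right R₁ R₂).trans (le_max_left _ 1)).trans hr
  have hR2' : r.val + R₂ ≤ L :=
    le_trans (Nat.add_le_add_left ((le_max_right R₁ R₂).trans (le_max_left _ 1)) _) hrL
  have hm1 : (1 : ℝ) ≤ ((min r.val (L - r.val) : ℕ) : ℝ) := by
    have h1 : 1 ≤ r.val := (le_max_right _ 1).trans hr
    have h2 : 1 ≤ L - r.val := by
      have := le_trans (Nat.add_le_add_left (le_max_right (max R₁ R₂) 1) _) hrL
      omega
    exact_mod_cast le_min h1 h2
  have hMpos : (0 : ℝ) < (M : ℝ) := by exact_mod_cast Nat.pos_of_ne_zero (NeZero.ne M)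
  set x : ℝ := Ξ * Real.sqrt (tubePairCompressibility L M Λ e U δ / tubeStiffness L M Λ e U δ) /
    (M : ℝ) with hx
  have hx0 : 0 ≤ x := by positivity
  have hpow1 : ((min r.val (L - r.val) : ℕ) : ℝ) ^ (-x) ≤ 1 :=
    Real.rpow_le_one_of_one_le_of_nonpos hm1 (by linarith)
  have hpow0 : 0 ≤ ((min r.val (L - r.val) : ℕ) : ℝ) ^ (-x) :=
    Real.rpow_nonneg (zero_le_one.trans hm1) _
  have hLM : (0 : ℝ) ≤ (L : ℝ) * (M : ℝ) ^ 2 := by positivity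
  by_cases hc : (L : ℝ) ≤ Real.exp (M : ℝ)
  · have key := hsub L M hLe hMe (le_of_max_le_left hM) hML (le_of_max_le_left hL) hc Λ e ψ hψ
      hGS r hR1 hR1'
    calc min A₁ A₂ * (L : ℝ) * (M : ℝ) ^ 2 * ((min r.val (L - r.val) : ℕ) : ℝ) ^ (-x)
          ≤ A₁ * (L : ℝ) * (M : ℝ) ^ 2 * 1 := by
            apply mul_le_mul _ hpow1 hpow0 (by positivity)
            have : min A₁ A₂ ≤ A₁ := min_le_left _ _
            nlinarith
      _ = A₁ * (L : ℝ) * (M : ℝ) ^ 2 := by ring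
      _ ≤ _ := key
  · have hc' : Real.exp (M : ℝ) < (L : ℝ) := lt_of_not_ge hc
    have key := hexp L M hLe hMe (le_of_max_le_right hM) hML (le_of_max_le_right hL) hc' Λ e ψ
      hψ hGS r hR2 hR2'
    calc min A₁ A₂ * (L : ℝ) * (M : ℝ) ^ 2 * ((min r.val (L - r.val) : ℕ) : ℝ) ^ (-x)
          ≤ A₂ * (L : ℝ) * (M : ℝ) ^ 2 * ((min r.val (L - r.val) : ℕ) : ℝ) ^ (-x) := by
            apply mul_le_mul_of_nonneg_right _ hpow0
            apply mul_le_mul_of_nonneg_right _ (sq_nonneg _)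
            exact mul_le_mul_of_nonneg_right (min_le_right _ _) (Nat.cast_nonneg L)
      _ ≤ _ := key

/-! ## F1 made actionable: the diagonal, exponent-free shadow the route consumes -/

/-- **DIAGONAL BRIDGE** — the part of the crux that `WidthHaldane.closes` actually consumes
(re-glue certificate `closes_diag` below): for every `U > 0`, `δ ∈ (0, 3/10)` and data, width-uniform
tube thermodynamics forces UNIFORM COLUMN `d_{x²-y²}` PAIR LRO OF THE SQUARE TORI — every normalised
sector ground state of the pure `L × L` Hubbard torus has `G_ψ(r) ≥ A·L³` for `R ≤ r̂`, `L ≥ L₁`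
even. Exponent-free; the `M = L` slice of `SubExpBridge`; a consequence of the crux
(`diagonalBridge_of_widthHaldaneBridge`). Open-problem strength: it is "superfluid stiffness (+ pair
compressibility) ⇒ d-wave pair ODLRO" for the 2D Hubbard ground state, the converse-Sewell direction
shared with `FluxSpectroscopy.FluxBridge`, plus `d_{x²-y²}` selection. [cite: Scalapino1995, §2 eq. (2.4)]
[cite: ScalapinoWhiteZhang1993, §II] -/
def DiagonalBridge : Prop :=
  ∀ U : ℝ, 0 < U → ∀ δ ∈ Set.Ioo (0 : ℝ) (3 / 10), ∀ (d₀ k₀ : ℝ) (M₁ L₀ : ℕ), 0 < d₀ →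
    UniformThermo U δ d₀ k₀ M₁ L₀ →
      ∃ A : ℝ, 0 < A ∧ ∃ R L₁ : ℕ, ∀ (L : ℕ) [NeZero L], Even L → L₁ ≤ L → UniformLROLM U δ L L A R

/-- The crux implies its diagonal shadow (via D1a at `M = L`, since `L ≤ e^L`). [folklore] -/
theorem diagonalBridge_of_widthHaldaneBridge (h : WidthHaldaneBridge) : DiagonalBridge := by
  intro U hU δ hδ d₀ k₀ M₁ L₀ hd₀ hth
  obtain ⟨A, hA, R, M₂, L₁, hsub⟩ := subExpBridge_of_widthHaldaneBridge h U hU δ hδ d₀ k₀ M₁ L₀ hd₀ hth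
  refine ⟨A, hA, R, max M₂ L₁, ?_⟩
  intro L _ hLe hL
  have hexp : (L : ℝ) ≤ Real.exp (L : ℝ) := by
    have := Real.add_one_le_exp (L : ℝ)
    linarith
  exact hsub L L hLe hLe (le_of_max_le_left hL) le_rfl (le_of_max_le_right hL) hexp

/-- 2D-ONLY HYPOTHESIS: twist stiffness and pair compressibility of the SQUARE tori alone
(the `M = L` slice of `UniformThermo`). [cite: ScalapinoWhiteZhang1993, §II] -/
def SquareThermo (U δ d₀ k₀ : ℝ) (L₀ : ℕ) : Prop :=
  ∀ (L : ℕ) [NeZero L], Even L → L₀ ≤ L → ∀ (Λ : Type) [LinearOrder Λ] [Fintype Λ]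
    (e : Λ ≃ ZMod L × ZMod L), d₀ ≤ tubeStiffness L L Λ e U δ ∧
      0 < tubePairCompressibility L L Λ e U δ ∧ tubePairCompressibility L L Λ e U δ ≤ k₀

/-- **SQUARE BRIDGE** (the honest 2D statement, STRONGER than `DiagonalBridge`: it uses only the
square tori's thermodynamics): stiffness floor and pair-compressibility window of the `L × L` tori
⇒ uniform column `d_{x²-y²}` pair LRO of every sector ground state. [cite: ScalapinoWhiteZhang1993, §II]
[cite: Scalapino1995, §2 eq. (2.4)] -/
def SquareBridge : Prop :=
  ∀ U : ℝ, 0 < U → ∀ δ ∈ Set.Ioo (0 : ℝ) (3 / 10), ∀ (d₀ k₀ : ℝ) (L₀ : ℕ), 0 < d₀ →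
    SquareThermo U δ d₀ k₀ L₀ →
      ∃ A : ℝ, 0 < A ∧ ∃ R L₁ : ℕ, ∀ (L : ℕ) [NeZero L], Even L → L₁ ≤ L → UniformLROLM U δ L L A R

/-- The family hypothesis contains the square one. [folklore] -/
theorem squareThermo_of_uniformThermo {U δ d₀ k₀ : ℝ} {M₁ L₀ : ℕ}
    (h : UniformThermo U δ d₀ k₀ M₁ L₀) : SquareThermo U δ d₀ k₀ (max M₁ L₀) := by
  intro L _ hLe hL Λ _ _ e
  exact h L L hLe hLe (le_of_max_le_left hL) le_rfl (le_of_max_le_right hL) Λ e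

/-- `SquareBridge → DiagonalBridge`. [folklore] -/
theorem diagonalBridge_of_squareBridge (h : SquareBridge) : DiagonalBridge := by
  intro U hU δ hδ d₀ k₀ M₁ L₀ hd₀ hth
  exact h U hU δ hδ d₀ k₀ (max M₁ L₀) hd₀ (squareThermo_of_uniformThermo hth)

/-- **RE-GLUE CERTIFICATE (F1 executed, for the tenure planner).** The parent route's deciding
theorem needs from stmt-16311 only its diagonal, exponent-free shadow: `DiagonalBridge` and
`WidthUniformThermodynamics` already give the summit. Proof = `WidthHaldane.closes` with step (1)
replaced by the diagonal law (no `rpow` bookkeeping: exponent `C = 0`) and steps (2)–(3) verbatim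
(read the diagonal on `FermionTorus 2 L`, then `PairFieldEvenSideLRO`). [folklore] -/
theorem closes_diag (h1 : DiagonalBridge) (h2 : WidthUniformThermodynamics) :
    _root_.HubbardSuperconductivity := by
  obtain ⟨U, hU, δ, hδ, d₀, hd₀, k₀, M₁, L₀, hth⟩ := widthUniformThermodynamics_iff.1 h2
  obtain ⟨A, hA, R, L₁, hlaw⟩ := h1 U hU δ hδ d₀ k₀ M₁ L₀ hd₀ hth
  refine ⟨U, hU, δ, ⟨hδ.1, hδ.2.trans (by norm_num)⟩, fun N ψ hE => ?_⟩
  obtain ⟨B, hB⟩ : ∃ B : ℝ, B = (∑ e ∈ insert (0 : Fin 2 → ℤ) Literature.MathematicalPhysics.QuantumLattice.unitSteps,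
      ‖((Literature.MathematicalPhysics.QuantumLattice.dWaveFormFactor e / Real.sqrt 2 : ℝ) : ℂ)‖ * 2) ^ 2 := ⟨_, rfl⟩
  obtain ⟨L₂, hL₂⟩ := Literature.MathematicalPhysics.QuantumLattice.exists_half_le_rpow_neg_div (0 : ℝ)
  refine Literature.MathematicalPhysics.QuantumLattice.hasLongRangeOrder_even_of_le Literature.MathematicalPhysics.QuantumLattice.dWaveFormFactor ψ (fun n hn => (hE (n + 1) hn).2.1)
    (by positivity : (0 : ℝ) < A / 8)
    (max (max L₁ L₂) ⌈8 * ((max R 1 : ℕ) : ℝ) * (A + 2 * B) / A⌉₊) ?_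
  intro n hev hK
  obtain ⟨hN, hn1, hGS⟩ := hE (n + 1) hev
  rw [hN] at hGS
  simp only [max_le_iff] at hK
  obtain ⟨⟨hL₁n, hL₂n⟩, hK⟩ := hK
  have hbig : 8 * ((max R 1 : ℕ) : ℝ) * (A + 2 * B) ≤ A * ((n + 1 : ℕ) : ℝ) := by
    have h1 := (Nat.le_ceil _).trans
      (show (⌈8 * ((max R 1 : ℕ) : ℝ) * (A + 2 * B) / A⌉₊ : ℝ) ≤ ((n + 1 : ℕ) : ℝ) by
        exact_mod_cast hK)
    rw [div_le_iff₀ hA] at h1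
    linarith
  subst hB
  simp only [Literature.MathematicalPhysics.QuantumLattice.pairFieldCorr_succ]
  refine Literature.MathematicalPhysics.QuantumLattice.sum_pairCorr_ge_of_columnLaw (ψ (n + 1)) hn1 hA (le_refl (0 : ℝ)) (le_max_right R 1)
    (fun r hr1 hr2 => ?_) (hL₂ (n + 1) hL₂n) hbig
  -- (2) the diagonal law on the carrier `FermionTorus 2 (n+1)` (verbatim from `WidthHaldane.closes`)
  obtain ⟨e₀, he₀, he₀s⟩ : ∃ e : Literature.MathematicalPhysics.QuantumLattice.FermionTorus 2 (n + 1) ≃ ZMod (n + 1) × ZMod (n + 1),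
      (∀ x, e x = (Literature.MathematicalPhysics.QuantumLattice.FermionTorus.toTorusSite x 0, Literature.MathematicalPhysics.QuantumLattice.FermionTorus.toTorusSite x 1)) ∧
        ∀ p : ZMod (n + 1) × ZMod (n + 1), e.symm p = Literature.MathematicalPhysics.QuantumLattice.FermionTorus.ofTorusSite ![p.1, p.2] :=
    ⟨Literature.MathematicalPhysics.QuantumLattice.FermionTorus.equivTorusSite.trans (finTwoArrowEquiv _), fun x => rfl, fun p => rfl⟩
  have hinj : ∀ u v : Literature.MathematicalPhysics.QuantumLattice.FermionTorus 2 (n + 1),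
      Literature.MathematicalPhysics.QuantumLattice.FermionTorus.toTorusSite u = Literature.MathematicalPhysics.QuantumLattice.FermionTorus.toTorusSite v ↔ u = v := fun u v =>
    (Literature.MathematicalPhysics.QuantumLattice.FermionTorus.equivTorusSite (d := 2) (L := n + 1)).injective.eq_iff
  have hsymm : ∀ (v : Literature.MathematicalPhysics.QuantumLattice.FermionTorus 2 (n + 1)) (p : ZMod (n + 1) × ZMod (n + 1)),
      v = e₀.symm p ↔ Literature.MathematicalPhysics.QuantumLattice.FermionTorus.toTorusSite v = ![p.1, p.2] := by
    intro v p
    rw [Equiv.eq_symm_apply, he₀, Prod.ext_iff, funext_iff, Fin.forall_fin_two]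
    simp
  have hS0 : ∀ t : Fin 2 → ZMod (n + 1), t + Pi.single 0 1 = ![t 0 + 1, t 1] := fun t => by
    funext i; fin_cases i <;> simp
  have hS1 : ∀ t : Fin 2 → ZMod (n + 1), t + Pi.single 1 1 = ![t 0, t 1 + 1] := fun t => by
    funext i; fin_cases i <;> simp
  have hp1 : ∀ t : Fin 2 → ZMod (n + 1), t + Literature.Probability.LatticeModels.Torus.proj (n + 1) (Pi.single 0 1) = ![t 0 + 1, t 1] :=
    fun t => by funext i; fin_cases i <;> simp
  have hp2 : ∀ t : Fin 2 → ZMod (n + 1), t + Literature.Probability.LatticeModels.Torus.proj (n + 1) (-Pi.single 0 1) = ![t 0 - 1, t 1] :=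
    fun t => by funext i; fin_cases i <;> simp [sub_eq_add_neg]
  have hp3 : ∀ t : Fin 2 → ZMod (n + 1), t + Literature.Probability.LatticeModels.Torus.proj (n + 1) (Pi.single 1 1) = ![t 0, t 1 + 1] :=
    fun t => by funext i; fin_cases i <;> simp
  have hp4 : ∀ t : Fin 2 → ZMod (n + 1), t + Literature.Probability.LatticeModels.Torus.proj (n + 1) (-Pi.single 1 1) = ![t 0, t 1 - 1] :=
    fun t => by funext i; fin_cases i <;> simp [sub_eq_add_neg]
  have hHc : ∀ (G₁ G₂ : SimpleGraph (Literature.MathematicalPhysics.QuantumLattice.FermionTorus 2 (n + 1))) (i₁ : DecidableRel G₁.Adj)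
      (i₂ : DecidableRel G₂.Adj), (∀ x y, G₁.Adj x y ↔ G₂.Adj x y) →
      @Literature.MathematicalPhysics.QuantumLattice.hamiltonian _ _ _ G₁ i₁ 1 U = @Literature.MathematicalPhysics.QuantumLattice.hamiltonian _ _ _ G₂ i₂ 1 U := by
    intro G₁ G₂ i₁ i₂ h
    have hG : G₁ = G₂ := by ext x y; exact h x y
    subst hG
    congr
  have hd1 : Literature.MathematicalPhysics.QuantumLattice.dWaveFormFactor (Pi.single 0 1) = 1 := if_pos (Or.inl rfl)
  have hd2 : Literature.MathematicalPhysics.QuantumLattice.dWaveFormFactor (-Pi.single 0 1) = 1 := if_pos (Or.inr rfl)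
  have hd3 : Literature.MathematicalPhysics.QuantumLattice.dWaveFormFactor (Pi.single 1 1) = -1 := by
    have hne1 : (Pi.single 1 1 : Fin 2 → ℤ) ≠ Pi.single 0 1 := fun h => by simpa using congrFun h 0
    have hne2 : (Pi.single 1 1 : Fin 2 → ℤ) ≠ -Pi.single 0 1 := fun h => by simpa using congrFun h 0
    rw [Literature.MathematicalPhysics.QuantumLattice.dWaveFormFactor, if_neg (not_or.2 ⟨hne1, hne2⟩), if_pos (Or.inl rfl)]
  have hd4 : Literature.MathematicalPhysics.QuantumLattice.dWaveFormFactor (-Pi.single 1 1) = -1 := by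
    have hne3 : (-Pi.single 1 1 : Fin 2 → ℤ) ≠ Pi.single 0 1 := fun h => by simpa using congrFun h 0
    have hne4 : (-Pi.single 1 1 : Fin 2 → ℤ) ≠ -Pi.single 0 1 := fun h => by simpa using congrFun h 1
    rw [Literature.MathematicalPhysics.QuantumLattice.dWaveFormFactor, if_neg (not_or.2 ⟨hne3, hne4⟩), if_pos (Or.inr rfl)]
  have hsum : ∀ {β : Type} [AddCommMonoid β] (f : (Fin 2 → ℤ) → β), ∑ e ∈ Literature.MathematicalPhysics.QuantumLattice.unitSteps, f e =
      f (Pi.single 0 1) + f (-Pi.single 0 1) + f (Pi.single 1 1) + f (-Pi.single 1 1) := by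
    intro β _ f
    have h1 : (Pi.single 0 1 : Fin 2 → ℤ) ∉
        ({-Pi.single 0 1, Pi.single 1 1, -Pi.single 1 1} : Finset (Fin 2 → ℤ)) := by
      simp only [Finset.mem_insert, Finset.mem_singleton]; decide
    have h2 : (-Pi.single 0 1 : Fin 2 → ℤ) ∉ ({Pi.single 1 1, -Pi.single 1 1} : Finset (Fin 2 → ℤ)) := by
      simp only [Finset.mem_insert, Finset.mem_singleton]; decide
    have h3 : (Pi.single 1 1 : Fin 2 → ℤ) ∉ ({-Pi.single 1 1} : Finset (Fin 2 → ℤ)) := by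
      simp only [Finset.mem_singleton]; decide
    rw [Literature.MathematicalPhysics.QuantumLattice.unitSteps, Finset.sum_insert h1, Finset.sum_insert h2, Finset.sum_insert h3,
      Finset.sum_singleton]
    abel
  have key := hlaw (n + 1) hev hL₁n (Literature.MathematicalPhysics.QuantumLattice.FermionTorus 2 (n + 1)) e₀ (ψ (n + 1)) hn1
  convert key ?gs r ((le_max_left R 1).trans hr1)
    (le_trans (Nat.add_le_add_left (le_max_left R 1) _) hr2) using 1
  case gs =>
    dsimp only [tubeH0, tubeFilling]
    convert hGS using 2
    · rw [Literature.MathematicalPhysics.QuantumLattice.hubbardTorus]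
      refine hHc _ _ _ _ fun x y => ?_
      simp only [SimpleGraph.fromRel_adj, Literature.MathematicalPhysics.QuantumLattice.fermionTorusGraph_adj, Literature.Probability.LatticeModels.torusGraph_adj_iff,
        Fin.exists_fin_two, hsymm, he₀, hS0, hS1, ne_eq, hinj]
    · simp only [sq]
  · rw [zero_div, neg_zero, Real.rpow_zero]
    ring
  · simp only [tubeColumnPairCorr, tubeDWavePair, Fin.sum_univ_four, Matrix.cons_val_zero, Matrix.cons_val_one, Matrix.cons_val,
      Equiv.apply_symm_apply]
    simp only [he₀s]
    refine Finset.sum_congr rfl fun a _ => ?_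
    rw [Matrix.conjTranspose_sum, Finset.sum_mul]
    simp only [Finset.mul_sum, Literature.MathematicalPhysics.QuantumLattice.expect_sum, Complex.re_sum]
    refine Finset.sum_congr rfl fun b _ => Finset.sum_congr rfl fun b' _ => ?_
    simp only [Literature.MathematicalPhysics.QuantumLattice.localPair_dWave_eq_localPairOn_unitSteps, Literature.MathematicalPhysics.QuantumLattice.localPairOn_eq_sum_singletBond, hsum,
      Literature.MathematicalPhysics.QuantumLattice.singletBond, hd1, hd2, hd3, hd4, hp1, hp2, hp3, hp4, Matrix.cons_val_zero,
      Matrix.cons_val_one]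

/-! ## First-lemma candidates (signatures; provability analysis in the census) -/

/-- Long-bond kinetic energy of a state: `K_ψ = Σ_{x,σ} Re⟨ψ, (c†_{x+e₁,σ} c_{xσ} + c†_{xσ} c_{x+e₁,σ}) ψ⟩`
(sum over the `L·M` longitudinal bonds). [cite: ScalapinoWhiteZhang1993, §II] -/
def longKinetic (L M : ℕ) (Λ : Type) [LinearOrder Λ] [Fintype Λ] (e : Λ ≃ ZMod L × ZMod M)
    (ψ : Fock (Orb Λ)) : ℝ :=
  ∑ x : Λ, ∑ σ : Fin 2,
    (expect (creation (orb (e.symm ((e x).1 + 1, (e x).2)) σ) * annihilation (orb x σ) +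
        creation (orb x σ) * annihilation (orb (e.symm ((e x).1 + 1, (e x).2)) σ)) ψ).re

/-- **KINETIC FLOOR** (candidate "M-uniform first lemma", STRENGTHEN heading): under
`UniformThermo`, every sector ground state of every admissible tube has long-bond kinetic energy
`(1 - cos(π/(3L)))·K_ψ ≥ (π/3)²·M·d₀/(2L)`, i.e. `K_ψ/(L·M) ≥ d₀·(1 - o(1))`: "twist stiffness per
site ≤ longitudinal kinetic energy per bond" — the Scalapino–White–Zhang f-sum inequality
`D_s ≤ ⟨-k_x⟩` read as a correlation FLOOR. Provable now (spread gauge + the `±θ` average of the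
landed `Theorems.WidthHaldane.re_expect_gauged_tubeH`, i.e. the tree's Bloch bound before its last
norm step), uniform in `M`, and USELESS for the crux: every metal satisfies it, it is one-body and
channel-blind (census §Strengthen S3). Stated, not asserted. [cite: ScalapinoWhiteZhang1993, §II] -/
def KineticFloor : Prop :=
  ∀ (U δ d₀ k₀ : ℝ) (M₁ L₀ : ℕ), UniformThermo U δ d₀ k₀ M₁ L₀ →
    ∀ (L M : ℕ) [NeZero L] [NeZero M], Even L → Even M → M₁ ≤ M → M ≤ L → L₀ ≤ L → 3 ≤ L →
      ∀ (Λ : Type) [LinearOrder Λ] [Fintype Λ] (e : Λ ≃ ZMod L × ZMod M), ∀ ψ : Fock (Orb Λ),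
        star ψ ⬝ᵥ ψ = 1 → IsGroundStateInSector (tubeH0 L M Λ e U) (tubeFilling L M δ) 0 ψ →
          (Real.pi / 3) ^ 2 * (M : ℝ) * d₀ / (2 * (L : ℝ)) ≤
            (1 - Real.cos (Real.pi / (3 * (L : ℝ)))) * longKinetic L M Λ e ψ

/-- **TOWER CEILING FROM THE DIAGONAL LAW** (NEGATION/tightness heading): uniform column d-wave pair
LRO of the square tori forces the Koma–Tasaki tower bound `E(N+2) + E(N-2) - 2E(N) ≤ 4k/L²`, i.e.
the compressibility CEILING clause of `UniformThermo` at `M = L` (trial states `Φψ`, `Φ†ψ` with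
`Φ = Σ_a Φ_a`; `‖Φψ‖² = Σ_r G_ψ(r) ≳ A·L⁴`, `‖Φ†ψ‖² = ‖Φψ‖² + O(L²)`, and the double commutator
`[Φ†,[H,Φ]]` has `O(L²)` bounded local terms). An M/L-sized provable lemma (not attempted here);
its use in the census: the ceiling `ẽ″ ≤ k₀` is NECESSARY for the diagonal conclusion, so a
counterexample to the crux can only live in the stiffness floor / `ẽ″ > 0` clauses, which are
channel-blind. Stated, not asserted. [cite: KomaTasaki1994, §2 Theorem 2.1 and §5] -/
def TowerCeilingOfDiagonalLRO : Prop :=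
  ∀ (U δ A : ℝ) (R L₁ : ℕ), 0 < A → (∀ (L : ℕ) [NeZero L], Even L → L₁ ≤ L → UniformLROLM U δ L L A R) →
    ∃ k : ℝ, ∃ L₂ : ℕ, ∀ (L : ℕ) [NeZero L], Even L → L₂ ≤ L →
      ∀ (Λ : Type) [LinearOrder Λ] [Fintype Λ] (e : Λ ≃ ZMod L × ZMod L),
        tubePairCompressibility L L Λ e U δ ≤ k


/-! ## Drop-in item signature for the tenure planner -/

/-- **`DiagonalBridge` in the route's own `let`-vocabulary** (character-for-character the
`let`-prefix of the item `WidthHaldaneBridge`, so that it elaborates in the route file, which cannot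
import `Theorems/WidthHaldaneDefs`): the signature to file with
`ledger workitem add --kind statement --route route-HubbardSuperconductivity-WidthHaldane --name DiagonalBridge --signature …`
if the tenure planner adopts F1. `diagonalBridgeRaw_iff` certifies it IS `DiagonalBridge` (`Iff.rfl`).
[cite: Scalapino1995, §2 eq. (2.4)] [cite: ScalapinoWhiteZhang1993, §II] -/
def DiagonalBridgeRaw : Prop :=
  open Matrix Literature.MathematicalPhysics.QuantumLattice in let H0 : ∀ (L M : ℕ) (Λ : Type) [LinearOrder Λ] [Fintype Λ], (Λ ≃ ZMod L × ZMod M) → ℝ → Matrix (Finset (Orb Λ)) (Finset (Orb Λ)) ℂ := fun _ _ Λ _ _ e U => hamiltonian (SimpleGraph.fromRel fun x y : Λ => y = e.symm ((e x).1 + 1, (e x).2) ∨ y = e.symm ((e x).1, (e x).2 + 1)) 1 U; let Tw : ∀ (L M : ℕ) [NeZero L] [NeZero M] (Λ : Type) [LinearOrder Λ] [Fintype Λ], (Λ ≃ ZMod L × ZMod M) → ℝ → Matrix (Finset (Orb Λ)) (Finset (Orb Λ)) ℂ := fun _ M _ _ _ _ _ e θ => ∑ b : ZMod M, ∑ σ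 : Fin 2, ((1 - Complex.exp (Complex.I * θ)) • (creation (orb (e.symm (0, b)) σ) * annihilation (orb (e.symm (-1, b)) σ)) + (1 - Complex.exp (-(Complex.I * θ))) • (creation (orb (e.symm (-1, b)) σ) * annihilation (orb (e.symm (0, b)) σ))); let E : ∀ (L M : ℕ) [NeZero L] [NeZero M] (Λ : Type) [LinearOrder Λ] [Fintype Λ], (Λ ≃ ZMod L × ZMod M) → ℝ → ℝ → ℕ → ℝ := fun L M _ _ Λ _ _ e U θ N => (H0 L M Λ e U + Tw L M Λ e θ).minEnergyOn (szSector N 0); let Np : ℕ → ℕ → ℝ → ℕ := fun L M δ => 2 * ⌊(1 - δ) * ((L : ℝ) * (M : ℝ)) / 2⌋₊; let stiff : ∀ (L M : ℕ) [NeZero L] [NeZero M] (Λ : Type) [LinearOrder Λ] [Fintype Λ], (Λ ≃ ZMod L × ZMod M) → ℝ → ℝ → ℝ := fun L M _ _ Λ _ _ e U δ => 2 * (L : ℝ) * (E L M Λ e U (Real.pi / 3) (Np L M δ) - E L M Λ e U 0 (Np L M δ)) / ((Real.pi / 3) ^ 2 * (M : ℝ)); let icomp : ∀ (L M : ℕ)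 [NeZero L] [NeZero M] (Λ : Type) [LinearOrder Λ] [Fintype Λ], (Λ ≃ ZMod L × ZMod M) → ℝ → ℝ → ℝ := fun L M _ _ Λ _ _ e U δ => (L : ℝ) * (M : ℝ) * (E L M Λ e U 0 (Np L M δ + 2) + E L M Λ e U 0 (Np L M δ - 2) - 2 * E L M Λ e U 0 (Np L M δ)) / 4; let P : ∀ (L M : ℕ) (Λ : Type) [LinearOrder Λ] [Fintype Λ], (Λ ≃ ZMod L × ZMod M) → Λ → Matrix (Finset (Orb Λ)) (Finset (Orb Λ)) ℂ := fun _ _ Λ _ _ e x => ∑ j : Fin 4, (((![1, 1, -1, -1] : Fin 4 → ℝ) j / Real.sqrt 2 : ℝ) : ℂ) • (annihilation (orb x 0) * annihilation (orb ((![e.symm ((e x).1 + 1, (e x).2), e.symm ((e x).1 - 1, (e x).2), e.symm ((e x).1, (e x).2 + 1), e.symm ((e x).1, (e x).2 - 1)] : Fin 4 → Λ) j) 1) - annihilation (orb x 1) * annihilation (orb ((![e.symm ((e x).1 + 1, (e x).2), e.symm ((e x).1 - 1, (e x).2), e.symm ((e x).1, (e x).2 + 1), e.symm ((e x).1, (e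 x).2 - 1)] : Fin 4 → Λ) j) 0)); let G : ∀ (L M : ℕ) [NeZero L] [NeZero M] (Λ : Type) [LinearOrder Λ] [Fintype Λ], (Λ ≃ ZMod L × ZMod M) → Fock (Orb Λ) → ZMod L → ℝ := fun L M _ _ Λ _ _ e ψ r => ∑ a : ZMod L, (expect ((∑ b : ZMod M, P L M Λ e (e.symm (a, b)))ᴴ * (∑ b : ZMod M, P L M Λ e (e.symm (a + r, b)))) ψ).re; ∀ U : ℝ, 0 < U → ∀ δ ∈ Set.Ioo (0 : ℝ) (3 / 10), ∀ (d₀ k₀ : ℝ) (M₁ L₀ : ℕ), 0 < d₀ → (∀ (L M : ℕ) [NeZero L] [NeZero M], Even L → Even M → M₁ ≤ M → M ≤ L → L₀ ≤ L → ∀ (Λ : Type) [LinearOrder Λ] [Fintype Λ] (e : Λ ≃ ZMod L × ZMod M), d₀ ≤ stiff L M Λ e U δ ∧ 0 < icomp L M Λ e U δ ∧ icomp L M Λ e U δ ≤ k₀) → ∃ A : ℝ, 0 < A ∧ ∃ R L₁ : ℕ, ∀ (L : ℕ) [NeZero L], Even L → L₁ ≤ L → ∀ (Λ : Type) [LinearOrder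 Λ] [Fintype Λ] (e : Λ ≃ ZMod L × ZMod L), ∀ ψ : Fock (Orb Λ), star ψ ⬝ᵥ ψ = 1 → IsGroundStateInSector (H0 L L Λ e U) (Np L L δ) 0 ψ → ∀ r : ZMod L, R ≤ r.val → r.val + R ≤ L → A * (L : ℝ) * (L : ℝ) ^ 2 ≤ G L L Λ e ψ r

/-- Faithfulness of the drop-in signature (`δζ`-convertibility). [folklore] -/
theorem diagonalBridgeRaw_iff : DiagonalBridgeRaw ↔ DiagonalBridge :=
  Iff.rfl

end Summit.HubbardSuperconductivity.HubbardSuperconductivity.Cruxes.WidthHaldaneBridge.StrategistG1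

end
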